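import Mathlib
import Literature.Barriers.FinalStateConjecture.NonSmoothNullInfinityRadius
import Summits.FinalStateConjecture.FinalStateConjecture.Theorems.PhotonSphereChannelsRWPotential

/-!
# Route PhotonSphereChannels — exponential tails: integrals of `e^{(y−c)/2M}` and of potentials below it

Helper file for the near (horizon-side) channel estimate of `FixedModeChannels`
(stmt-FinalStateConjecture-10048). The Regge–Wheeler potential along the tortoise line satisfies
`V(r x) ≤ B · exp((x − xc)/(2M))` (`Theorems.rwPotential_tortoise_le_exp`, with
`B = (ℓ(ℓ+1)+1)/(2M)³ · exp((r*(3M) − 2M)/(2M))`). This file turns such a pointwise exponential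
bound for a continuous `W ≥ 0` into the three tail quantities the estimate consumes:

* `∫_{−∞}^b e^{(y−c)/2M} dy = 2M e^{(b−c)/2M}` and `∫_{−∞}^b (b − y) e^{(y−c)/2M} dy = 4M² e^{(b−c)/2M}`
  (antiderivatives `2M e^{(y−c)/2M}` and `(2M(b−y) + 4M²) e^{(y−c)/2M}`);
* for `0 ≤ W ≤ B e^{(y−c)/2M}`: `W` and `(b − y)W` are integrable on `(−∞, b]` with
  `∫_{−∞}^b W ≤ 2MB e^{(b−c)/2M}` (Duhamel smallness / derivative of the recessive solution),
  `∫_{−∞}^b (b−y)W ≤ 4M²B e^{(b−c)/2M}` (Volterra contraction constant and Hardy constant), and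
  `W(y) ≤ B e^{(b−c)/2M}` for `y ≤ b` (sup on the cone slice);
* the specialisation to the Regge–Wheeler potential along any tortoise radius function.
-/

noncomputable section

namespace Summit.FinalStateConjecture.FinalStateConjecture.Theorems

open Literature.Barriers.FinalStateConjecture MeasureTheory Real Set Filter Topology

section ExpTails

variable {M : ℝ}

/-- `y ↦ 2M e^{(y−c)/2M}` is an antiderivative of `e^{(y−c)/2M}` (`M ≠ 0`). -/
theorem hasDerivAt_exp_tail (hM : M ≠ 0) (c y : ℝ) :
    HasDerivAt (fun y => 2 * M * exp ((y - c) / (2 * M))) (exp ((y - c) / (2 * M))) y := by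
  have h2M : 2 * M ≠ 0 := mul_ne_zero two_ne_zero hM
  have hlin : HasDerivAt (fun y => (y - c) / (2 * M)) (1 / (2 * M)) y := by
    simpa using ((hasDerivAt_id y).sub_const c).div_const (2 * M)
  have := (hlin.exp).const_mul (2 * M)
  refine this.congr_deriv ?_
  field_simp

/-- `e^{(y−c)/2M} → 0` as `y → −∞` (`M > 0`). -/
theorem tendsto_exp_tail_atBot (hM : 0 < M) (c : ℝ) :
    Tendsto (fun y => exp ((y - c) / (2 * M))) atBot (𝓝 0) := by
  refine Real.tendsto_exp_atBot.comp ?_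
  refine tendsto_atBot_atBot.2 fun b => ⟨2 * M * b + c, fun y hy => ?_⟩
  rw [div_le_iff₀ (by positivity)]
  linarith

/-- **Tail integral of the exponential**: `e^{(y−c)/2M}` is integrable on `(−∞, b]` and
`∫_{−∞}^b e^{(y−c)/2M} dy = 2M e^{(b−c)/2M}` (`M > 0`). -/
theorem integral_Iic_exp_tail (hM : 0 < M) (b c : ℝ) :
    IntegrableOn (fun y => exp ((y - c) / (2 * M))) (Iic b) ∧
      ∫ y in Iic b, exp ((y - c) / (2 * M)) = 2 * M * exp ((b - c) / (2 * M)) := by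
  have hder := hasDerivAt_exp_tail hM.ne' c
  have hlim : Tendsto (fun y => 2 * M * exp ((y - c) / (2 * M))) atBot (𝓝 0) := by
    simpa using (tendsto_exp_tail_atBot hM c).const_mul (2 * M)
  have hint : IntegrableOn (fun y => exp ((y - c) / (2 * M))) (Iic b) :=
    integrableOn_Iic_deriv_of_nonneg' (fun y _ => hder y) (fun y _ => (exp_pos _).le) hlim
  refine ⟨hint, ?_⟩
  rw [integral_Iic_of_hasDerivAt_of_tendsto' (fun y _ => hder y) hint hlim, sub_zero]

/-- **Weighted tail integral of the exponential**: `(b − y) e^{(y−c)/2M}` is integrable on `(−∞, b]`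
and `∫_{−∞}^b (b − y) e^{(y−c)/2M} dy = 4M² e^{(b−c)/2M}` (`M > 0`; antiderivative
`(2M(b − y) + 4M²) e^{(y−c)/2M}`). -/
theorem integral_Iic_weight_exp_tail (hM : 0 < M) (b c : ℝ) :
    IntegrableOn (fun y => (b - y) * exp ((y - c) / (2 * M))) (Iic b) ∧
      ∫ y in Iic b, (b - y) * exp ((y - c) / (2 * M)) = 4 * M ^ 2 * exp ((b - c) / (2 * M)) := by
  have h2M : 2 * M ≠ 0 := by positivity
  set g : ℝ → ℝ := fun y => (2 * M * (b - y) + 4 * M ^ 2) * exp ((y - c) / (2 * M)) with hg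
  have hder : ∀ y, HasDerivAt g ((b - y) * exp ((y - c) / (2 * M))) y := by
    intro y
    have hlin : HasDerivAt (fun y => (y - c) / (2 * M)) (1 / (2 * M)) y := by
      simpa using ((hasDerivAt_id y).sub_const c).div_const (2 * M)
    have hpoly : HasDerivAt (fun y => 2 * M * (b - y) + 4 * M ^ 2) (2 * M * (0 - 1)) y := by
      have := (((hasDerivAt_const y b).sub (hasDerivAt_id y)).const_mul (2 * M)).add_const (4 * M ^ 2)
      simpa using this
    have := hpoly.mul hlin.exp
    refine this.congr_deriv ?_
    field_simp
    ring
  have hlim : Tendsto g atBot (𝓝 0) := by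
    -- `g y = (2M t + 4M²) e^{-t/2M} e^{(b-c)/2M}` with `t = b - y → +∞`
    have h1 : Tendsto (fun y => b - y) atBot atTop :=
      tendsto_atTop_add_const_left atBot b tendsto_neg_atBot_atTop
    have h2 : Tendsto (fun t : ℝ => t * exp (-t / (2 * M))) atTop (𝓝 0) := by
      have := (Real.tendsto_pow_mul_exp_neg_atTop_nhds_zero 1).comp
        (Filter.Tendsto.atTop_div_const (by positivity : (0 : ℝ) < 2 * M) tendsto_id)
      have heq : (fun t : ℝ => t * exp (-t / (2 * M)))
          = fun t => (2 * M) * ((fun x : ℝ => x ^ 1 * exp (-x)) ∘ fun t => id t / (2 * M)) t := by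
        funext t
        simp only [Function.comp, id, pow_one, neg_div]
        field_simp
      rw [heq]
      simpa using this.const_mul (2 * M)
    have h3 : Tendsto (fun t : ℝ => exp (-t / (2 * M))) atTop (𝓝 0) := by
      refine Real.tendsto_exp_atBot.comp ?_
      refine tendsto_atTop_atBot.2 fun b' => ⟨-(2 * M * b'), fun t ht => ?_⟩
      rw [div_le_iff₀ (by positivity)]
      linarith
    have h4 : Tendsto (fun t : ℝ => (2 * M * t + 4 * M ^ 2) * exp (-t / (2 * M))) atTop (𝓝 0) := by
      have := (h2.const_mul (2 * M)).add (h3.const_mul (4 * M ^ 2))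
      simp only [mul_zero, add_zero] at this
      refine this.congr fun t => ?_
      ring
    have h5 := (h4.comp h1).mul_const (exp ((b - c) / (2 * M)))
    rw [zero_mul] at h5
    refine h5.congr fun y => ?_
    simp only [hg, Function.comp]
    rw [mul_assoc, ← Real.exp_add]
    congr 1
    congr 1
    field_simp
    ring
  have hnn : ∀ y ∈ Iic b, 0 ≤ (b - y) * exp ((y - c) / (2 * M)) := fun y hy =>
    mul_nonneg (sub_nonneg.2 hy) (exp_pos _).le
  have hint : IntegrableOn (fun y => (b - y) * exp ((y - c) / (2 * M))) (Iic b) :=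
    integrableOn_Iic_deriv_of_nonneg' (fun y _ => hder y) hnn hlim
  refine ⟨hint, ?_⟩
  rw [integral_Iic_of_hasDerivAt_of_tendsto' (fun y _ => hder y) hint hlim, sub_zero]
  simp [hg]

end ExpTails

/-! ### Potentials below an exponential tail -/

section Below

variable {M B c : ℝ} {W : ℝ → ℝ}

/-- If `0 ≤ W ≤ B e^{(y−c)/2M}` with `W` continuous (`M > 0`), then `W` is integrable on `(−∞, b]`
and `∫_{−∞}^b W ≤ 2MB e^{(b−c)/2M}`. -/
theorem integral_Iic_le_of_le_exp (hM : 0 < M) (hW : Continuous W) (hW0 : ∀ y, 0 ≤ W y)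
    (hWB : ∀ y, W y ≤ B * exp ((y - c) / (2 * M))) (b : ℝ) :
    IntegrableOn W (Iic b) ∧ ∫ y in Iic b, W y ≤ 2 * M * B * exp ((b - c) / (2 * M)) := by
  obtain ⟨hEi, hE⟩ := integral_Iic_exp_tail hM b c
  have hdom : IntegrableOn (fun y => B * exp ((y - c) / (2 * M))) (Iic b) := hEi.const_mul B
  have hint : IntegrableOn W (Iic b) :=
    Integrable.mono' hdom hW.aestronglyMeasurable (Eventually.of_forall fun y => by
      rw [Real.norm_eq_abs, abs_of_nonneg (hW0 y)]; exact hWB y)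
  refine ⟨hint, ?_⟩
  calc (∫ y in Iic b, W y) ≤ ∫ y in Iic b, B * exp ((y - c) / (2 * M)) :=
        setIntegral_mono_on hint hdom measurableSet_Iic fun y _ => hWB y
    _ = 2 * M * B * exp ((b - c) / (2 * M)) := by
        rw [MeasureTheory.integral_const_mul, hE]; ring

/-- If `0 ≤ W ≤ B e^{(y−c)/2M}` with `W` continuous (`M > 0`), then `(b − y)W` is integrable on
`(−∞, b]` and `∫_{−∞}^b (b − y) W ≤ 4M²B e^{(b−c)/2M}`. -/
theorem integral_Iic_weight_le_of_le_exp (hM : 0 < M) (hW : Continuous W) (hW0 : ∀ y, 0 ≤ W y)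
    (hWB : ∀ y, W y ≤ B * exp ((y - c) / (2 * M))) (b : ℝ) :
    IntegrableOn (fun y => (b - y) * W y) (Iic b) ∧
      ∫ y in Iic b, (b - y) * W y ≤ 4 * M ^ 2 * B * exp ((b - c) / (2 * M)) := by
  obtain ⟨hEi, hE⟩ := integral_Iic_weight_exp_tail hM b c
  have hdom : IntegrableOn (fun y => B * ((b - y) * exp ((y - c) / (2 * M)))) (Iic b) :=
    hEi.const_mul B
  have hmeas : AEStronglyMeasurable (fun y => (b - y) * W y) (volume.restrict (Iic b)) :=
    ((continuous_const.sub continuous_id).mul hW).aestronglyMeasurable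
  have hle : ∀ y ∈ Iic b, (b - y) * W y ≤ B * ((b - y) * exp ((y - c) / (2 * M))) := by
    intro y hy
    have hby : 0 ≤ b - y := sub_nonneg.2 hy
    calc (b - y) * W y ≤ (b - y) * (B * exp ((y - c) / (2 * M))) :=
          mul_le_mul_of_nonneg_left (hWB y) hby
      _ = _ := by ring
  have hint : IntegrableOn (fun y => (b - y) * W y) (Iic b) :=
    Integrable.mono' hdom hmeas (ae_restrict_of_forall_mem measurableSet_Iic fun y hy => by
      rw [Real.norm_eq_abs, abs_of_nonneg (mul_nonneg (sub_nonneg.2 hy) (hW0 y))]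
      exact hle y hy)
  refine ⟨hint, ?_⟩
  calc (∫ y in Iic b, (b - y) * W y) ≤ ∫ y in Iic b, B * ((b - y) * exp ((y - c) / (2 * M))) :=
        setIntegral_mono_on hint hdom measurableSet_Iic hle
    _ = 4 * M ^ 2 * B * exp ((b - c) / (2 * M)) := by
        rw [MeasureTheory.integral_const_mul, hE]; ring

/-- If `W ≤ B e^{(y−c)/2M}` with `B ≥ 0`, `M > 0`, then `W(y) ≤ B e^{(b−c)/2M}` for all `y ≤ b`. -/
theorem le_exp_of_le_of_le_exp (hM : 0 < M) (hB : 0 ≤ B)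
    (hWB : ∀ y, W y ≤ B * exp ((y - c) / (2 * M))) {b y : ℝ} (hy : y ≤ b) :
    W y ≤ B * exp ((b - c) / (2 * M)) := by
  refine (hWB y).trans (mul_le_mul_of_nonneg_left (exp_le_exp.2 ?_) hB)
  exact div_le_div_of_nonneg_right (by linarith) (by positivity)

end Below

/-! ### The Regge–Wheeler potential along a tortoise radius function -/

section RW

variable {M : ℝ} {r : ℝ → ℝ} {xc : ℝ}

/-- **Exponential tail of the Regge–Wheeler potential, product form.** Under the `r`-hypotheses of the
route's linear items (`M > 0`): for all `s, ℓ, x`,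
`V_{s,ℓ}(r x) ≤ B · exp((x − xc)/(2M))` with
`B = (ℓ(ℓ+1)+1)/(2M)³ · exp((r*(3M) − 2M)/(2M))`, `r* = efTortoiseCoord M`. -/
theorem rwPotential_tortoise_le_const_mul_exp (hM : 0 < M) (hr : ∀ x, 2 * M < r x)
    (hr' : ∀ x, HasDerivAt r (1 - 2 * M / r x) x) (hxc : r xc = 3 * M) (s ℓ : ℕ) (x : ℝ) :
    (1 - 2 * M / r x) * ((ℓ : ℝ) * ((ℓ : ℝ) + 1) / r x ^ 2 + (1 - (s : ℝ) ^ 2) * (2 * M) / r x ^ 3)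
      ≤ (((ℓ : ℝ) * ((ℓ : ℝ) + 1) + 1) / (2 * M) ^ 3
          * exp ((efTortoiseCoord M (3 * M) - 2 * M) / (2 * M))) * exp ((x - xc) / (2 * M)) := by
  have h := rwPotential_tortoise_le_exp hM hr hr' hxc s ℓ x
  rw [mul_assoc, ← Real.exp_add]
  convert h using 2
  congr 1
  field_simp
  ring

/-- The constant `B` of `rwPotential_tortoise_le_const_mul_exp` is positive. -/
theorem rwTailConst_pos (hM : 0 < M) (ℓ : ℕ) :
    0 < ((ℓ : ℝ) * ((ℓ : ℝ) + 1) + 1) / (2 * M) ^ 3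
      * exp ((efTortoiseCoord M (3 * M) - 2 * M) / (2 * M)) := by
  positivity

end RW

end Summit.FinalStateConjecture.FinalStateConjecture.Theorems
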